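import Summits.ValiantsHypothesis.ValiantsHypothesis.Theorems.KPlusLogSqLawTropicalBPotentialComplete
import Summits.ValiantsHypothesis.ValiantsHypothesis.Theorems.KPlusLogSqLawTropicalBMasterLawConverse
import Summits.ValiantsHypothesis.ValiantsHypothesis.Theorems.KPlusLogSqLawTropicalBSplitDefs

/-!
# Route «KPlusLogSqLaw», crux `TropicalB` (stmt-ValiantsHypothesis-19771) — THE POTENTIAL-CLOUD NORMAL FORM:
# a term sequence is a dominant chain of SOME design iff it carries per-step potentials whose gauged scores are
# minimised, incidence by incidence, exactly on the usage set (the design itself is eliminated)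

HONEST FRAMING.  Helper file (cell `pub-symmetroid`, seat val-sym-trop-p1 g27, 2026-08-29; `--supports stmt-ValiantsHypothesis-19771
--as helper`) toward the registered stubs `stub_tropThin` / `stub_tropFat` of `Cruxes/TropicalB/Lines/birth.lean` (crux
`Summit.ValiantsHypothesis.ValiantsHypothesis.Theses.KPlusLogSqLaw.TropicalB`, route `KPlusLogSqLaw`).  A NORMAL FORM (an equivalence), the PRIMAL–DUAL
twin of the realisability dual `MasterLaw.exists_design_iff_no_certificate` (val-sym-trop-p1 g26, p694913): it bounds nothing; `TropicalB`, both stubs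
and the residual of record (long carries) stay OPEN; nothing here bears on `WeakLifting`, DoorA26 / DoorA34, `MatrixDescartes`
(stmt-ValiantsHypothesis-18050) or VP ≠ VNP.  Route-independent (no `Theses` import).

THE STATEMENT.  Fix exponents `d : Fin K → ℕ` and a term sequence `p 0, …, p n` (terms `(σ, λ) : Equiv.Perm (Fin m) × (Fin m → Fin K)`;
the INCIDENCE of `p k` in column `b` is `((p k).1 b, b, (p k).2 b)`).  For integer slopes `θ k` and rational row / column potentials
`u k, w k : Fin m → ℚ` put, for the incidence `(a, b, l)` of `p k` in column `b`,

  `g k' := u k' a + w k' b − θ k' · d l`     (the GAUGED SCORE of that incidence at step `k'`).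

* `potentialClouds_of_design` — if every `p k` (`k ≤ n`) is the unique optimum of a design `(d, v, ε)` at `θ k`, then there are rational
  potentials with `g k ≤ g k'` for all `k, k' ≤ n` and every column `b`, STRICTLY unless `p k'` has the same incidence in column `b`
  (strict complementary slackness per step, `PotentialCertificate.exists_scaledPotential_of_isDominant`, divided by its scale; the common
  value of the scores over the usage set is `−v`).
* `design_of_potentialClouds` — conversely such potentials (at strictly increasing integer slopes) give a design: valuations
  `v := −N·(the common minimal score)` on the CANONICAL SUPPORT (presence `= 1` exactly on the incidences of the chain), slopes `N·θ k`,
  `N` a common denominator (`MasterLaw.exists_nat_mul_integral`); dominance by `TropicalCensus.isDominant_of_scaledPotential`.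
* `exists_design_iff_potentialClouds` — **a term sequence is realisable as a dominant chain (∃ v ε θ) iff it carries a POTENTIAL CLOUD**:
  slopes and `2m` potential sequences such that, for every chain incidence, the step-indexed scores are minimal exactly at the steps using it.
  Same left-hand side as `MasterLaw.exists_design_iff_no_certificate` (Farkas side); this is the primal side with the design eliminated.
* `tropRowD_iff_potentialClouds` — the unsigned census row `TropRowD m K B` (…TropicalBSplitDefs) as a bound for sequences with consecutive
  terms distinct that carry a potential cloud.

GEOMETRIC READING (located use, memo TB-LANDSCAPE-g27 §3).  For a cell `(a, b)` the points `(θ k, u k a + w k b) ∈ ℚ²`, `k ≤ n`, form a CLOUD; the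
cell is used with class `l` at step `k` iff its `k`-th point is a lower-hull contact point of the cloud in direction `d l`.  Per-cell class
monotonicity, «a return is an excursion of the cloud above a hull edge», and — summing the slack inequalities around the cycles of `σ_j⁻¹σ_k` —
the pairwise exchange law are immediate in this picture; a uniform construction (counter / box family) is the same thing as `2m` explicit
potential sequences with prescribed hull-contact combinatorics.  [folklore: LP duality for the assignment problem, step by step; packaging of the cell]
-/

set_option linter.dupNamespace false
set_option autoImplicit false

namespace Summit.ValiantsHypothesis.ValiantsHypothesis.Theorems.KPlusLogSqLaw

open Summit.ValiantsHypothesis.ValiantsHypothesis.Theorems.MatrixDescartes.Negative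
open Summit.ValiantsHypothesis.ValiantsHypothesis.Theorems.LacunarySymmetroidMatrixDescartes
open Summit.ValiantsHypothesis.ValiantsHypothesis.Theorems.LacunarySymmetroidMatrixDescartes.TropicalCensus
open scoped BigOperators
open Finset

namespace PotentialClouds

variable {m K : ℕ}

/-- **Design ⇒ potential cloud.**  If `p k` is the unique optimum of `(d, v, ε)` at `θ k` for every `k ≤ n`, there are rational potentials
`u k, w k` whose gauged scores of each chain incidence are minimal exactly on its usage set: `≤` always, `<` unless `p k'` carries the same
incidence in that column. [folklore: per-step strict complementary slackness] -/
theorem potentialClouds_of_design (d : Fin K → ℕ) (n : ℕ) (p : ℕ → Equiv.Perm (Fin m) × (Fin m → Fin K))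
    (v ε : Fin m → Fin m → Fin K → ℤ) (θ : ℕ → ℤ) (hdom : ∀ k ≤ n, IsDominant d v ε (θ k) (p k)) :
    ∃ u w : ℕ → Fin m → ℚ, ∀ k ≤ n, ∀ k' ≤ n, ∀ b : Fin m,
      (u k ((p k).1 b) + w k b - (θ k : ℚ) * (d ((p k).2 b) : ℚ) ≤
          u k' ((p k).1 b) + w k' b - (θ k' : ℚ) * (d ((p k).2 b) : ℚ)) ∧
      (¬ ((p k').1 b = (p k).1 b ∧ (p k').2 b = (p k).2 b) →
        u k ((p k).1 b) + w k b - (θ k : ℚ) * (d ((p k).2 b) : ℚ) <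
          u k' ((p k).1 b) + w k' b - (θ k' : ℚ) * (d ((p k).2 b) : ℚ)) := by
  classical
  have H : ∀ k, k ≤ n → ∃ S : ℤ, 0 < S ∧ ∃ u w : Fin m → ℤ,
      (∀ i, ε ((p k).1 i) i ((p k).2 i) ≠ 0) ∧
      (∀ i, u ((p k).1 i) + w i = S * (θ k * (d ((p k).2 i) : ℤ) - v ((p k).1 i) i ((p k).2 i))) ∧
      (∀ a b l, ε a b l ≠ 0 → ((p k).1 b ≠ a ∨ (p k).2 b ≠ l) → S * (θ k * (d l : ℤ) - v a b l) < u a + w b) :=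
    fun k hk => PotentialCertificate.exists_scaledPotential_of_isDominant d v ε (θ k) (p k).1 (p k).2 (hdom k hk)
  choose! S hS U W hpres htight hslack using H
  refine ⟨fun k a => (U k a : ℚ) / (S k : ℚ), fun k b => (W k b : ℚ) / (S k : ℚ), ?_⟩
  intro k hk k' hk' b
  -- the incidence of `p k` in column `b`
  set a := (p k).1 b with ha
  set l := (p k).2 b with hl
  have hSk : (0 : ℚ) < (S k : ℚ) := by exact_mod_cast hS k hk
  have hSk' : (0 : ℚ) < (S k' : ℚ) := by exact_mod_cast hS k' hk'
  -- the score at `k` is `−v`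
  have e1 : (U k a : ℚ) / (S k : ℚ) + (W k b : ℚ) / (S k : ℚ) - (θ k : ℚ) * (d l : ℚ) = - (v a b l : ℚ) := by
    have ht : ((U k a + W k b : ℤ) : ℚ) = ((S k * (θ k * (d l : ℤ) - v a b l) : ℤ) : ℚ) := by
      exact_mod_cast htight k hk b
    push_cast at ht
    rw [← add_div, ht, mul_div_cancel_left₀ _ (ne_of_gt hSk)]
    ring
  -- the score at `k'` is `≥ −v`, strictly unless the incidence is shared
  have e2 : - (v a b l : ℚ) ≤ (U k' a : ℚ) / (S k' : ℚ) + (W k' b : ℚ) / (S k' : ℚ) - (θ k' : ℚ) * (d l : ℚ) ∧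
      (¬ ((p k').1 b = a ∧ (p k').2 b = l) →
        - (v a b l : ℚ) < (U k' a : ℚ) / (S k' : ℚ) + (W k' b : ℚ) / (S k' : ℚ) - (θ k' : ℚ) * (d l : ℚ)) := by
    by_cases hsame : (p k').1 b = a ∧ (p k').2 b = l
    · obtain ⟨h1, h2⟩ := hsame
      have ht : ((U k' ((p k').1 b) + W k' b : ℤ) : ℚ) =
          ((S k' * (θ k' * (d ((p k').2 b) : ℤ) - v ((p k').1 b) b ((p k').2 b)) : ℤ) : ℚ) := by
        exact_mod_cast htight k' hk' b
      rw [h1, h2] at ht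
      push_cast at ht
      have e : (U k' a : ℚ) / (S k' : ℚ) + (W k' b : ℚ) / (S k' : ℚ) - (θ k' : ℚ) * (d l : ℚ) = - (v a b l : ℚ) := by
        rw [← add_div, ht, mul_div_cancel_left₀ _ (ne_of_gt hSk')]
        ring
      exact ⟨le_of_eq e.symm, fun h => absurd ⟨h1, h2⟩ h⟩
    · have hne : (p k').1 b ≠ a ∨ (p k').2 b ≠ l := by
        by_contra hcon
        push Not at hcon
        exact hsame hcon
      have hsl : ((S k' * (θ k' * (d l : ℤ) - v a b l) : ℤ) : ℚ) < ((U k' a + W k' b : ℤ) : ℚ) := by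
        exact_mod_cast hslack k' hk' a b l (hpres k hk b) hne
      push_cast at hsl
      have e : (θ k' : ℚ) * (d l : ℚ) - (v a b l : ℚ) < ((U k' a : ℚ) + (W k' b : ℚ)) / (S k' : ℚ) := by
        rw [lt_div_iff₀ hSk']
        linarith
      rw [← add_div]
      exact ⟨by linarith, fun _ => by linarith⟩
  refine ⟨?_, fun hns => ?_⟩
  · rw [e1]; exact e2.1
  · rw [e1]; exact e2.2 hns

/-- **Potential cloud ⇒ design** (canonical support).  Rational potentials at strictly increasing integer slopes whose gauged scores of every
chain incidence are minimal exactly on its usage set give integer valuations `v`, the presence pattern `ε = 1` exactly on the chain's incidences,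
and (scaled) slopes making every `p k` the unique optimum. [folklore: LP duality, clearing denominators] -/
theorem design_of_potentialClouds (d : Fin K → ℕ) (n : ℕ) (p : ℕ → Equiv.Perm (Fin m) × (Fin m → Fin K))
    (θ : ℕ → ℤ) (hθ : ∀ k < n, θ k < θ (k + 1)) (u w : ℕ → Fin m → ℚ)
    (hcloud : ∀ k ≤ n, ∀ k' ≤ n, ∀ b : Fin m,
      (u k ((p k).1 b) + w k b - (θ k : ℚ) * (d ((p k).2 b) : ℚ) ≤
          u k' ((p k).1 b) + w k' b - (θ k' : ℚ) * (d ((p k).2 b) : ℚ)) ∧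
      (¬ ((p k').1 b = (p k).1 b ∧ (p k').2 b = (p k).2 b) →
        u k ((p k).1 b) + w k b - (θ k : ℚ) * (d ((p k).2 b) : ℚ) <
          u k' ((p k).1 b) + w k' b - (θ k' : ℚ) * (d ((p k).2 b) : ℚ))) :
    ∃ (v : Fin m → Fin m → Fin K → ℤ) (θ' : ℕ → ℤ), (∀ k < n, θ' k < θ' (k + 1)) ∧
      ∀ k ≤ n, IsDominant d v (fun a b l => if ∃ k' ≤ n, (p k').1 b = a ∧ (p k').2 b = l then 1 else 0) (θ' k) (p k) := by
  classical
  -- clear denominators of the finitely many potentials that matter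
  obtain ⟨N, hNpos, hN⟩ := MasterLaw.exists_nat_mul_integral
    (Sum.elim (fun q : Fin (n + 1) × Fin m => u q.1 q.2) (fun q : Fin (n + 1) × Fin m => w q.1 q.2))
  choose z hz using hN
  let U : ℕ → Fin m → ℤ := fun k a => if h : k < n + 1 then z (Sum.inl (⟨k, h⟩, a)) else 0
  let W : ℕ → Fin m → ℤ := fun k b => if h : k < n + 1 then z (Sum.inr (⟨k, h⟩, b)) else 0
  have hU : ∀ k ≤ n, ∀ a, (U k a : ℚ) = (N : ℚ) * u k a := by
    intro k hk a
    have h : k < n + 1 := Nat.lt_succ_of_le hk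
    simp only [U, dif_pos h]
    exact (hz (Sum.inl (⟨k, h⟩, a))).symm
  have hW : ∀ k ≤ n, ∀ b, (W k b : ℚ) = (N : ℚ) * w k b := by
    intro k hk b
    have h : k < n + 1 := Nat.lt_succ_of_le hk
    simp only [W, dif_pos h]
    exact (hz (Sum.inr (⟨k, h⟩, b))).symm
  have hNq : (0 : ℚ) < (N : ℚ) := by exact_mod_cast hNpos
  -- the gauged score, scaled by `N`, as an integer
  let sc : ℕ → Fin m → Fin m → Fin K → ℤ := fun k a b l => U k a + W k b - (N : ℤ) * θ k * (d l : ℤ)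
  have hsc : ∀ k ≤ n, ∀ a b l, (sc k a b l : ℚ) =
      (N : ℚ) * (u k a + w k b - (θ k : ℚ) * (d l : ℚ)) := by
    intro k hk a b l
    simp only [sc]
    push_cast
    rw [hU k hk a, hW k hk b]
    ring
  -- valuations: minus the (common) minimal scaled score on the canonical support
  let v : Fin m → Fin m → Fin K → ℤ := fun a b l =>
    if h : ∃ k, k ≤ n ∧ (p k).1 b = a ∧ (p k).2 b = l then - sc (Classical.choose h) a b l else 0
  refine ⟨v, fun k => (N : ℤ) * θ k, fun k hk => ?_, fun k hk => ?_⟩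
  · exact Int.mul_lt_mul_of_pos_left (hθ k hk) (by exact_mod_cast hNpos)
  -- dominance at step `k` through the scaled potential certificate (scale `1`)
  refine isDominant_of_scaledPotential d v _ ((N : ℤ) * θ k) (p k).1 (p k).2 1 one_pos (U k) (W k) ?_ ?_ ?_
  · -- presence of the chain's own incidences
    intro i
    have hex : ∃ k' ≤ n, (p k').1 i = (p k).1 i ∧ (p k').2 i = (p k).2 i := ⟨k, hk, rfl, rfl⟩
    rw [if_pos hex]
    exact one_ne_zero
  · -- tightness: the score at `k` equals the score at the chosen user of the incidence
    intro i
    have hex : ∃ k', k' ≤ n ∧ (p k').1 i = (p k).1 i ∧ (p k').2 i = (p k).2 i := ⟨k, hk, rfl, rfl⟩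
    have hv : v ((p k).1 i) i ((p k).2 i) = - sc (Classical.choose hex) ((p k).1 i) i ((p k).2 i) := by
      simp only [v, dif_pos hex]
    obtain ⟨hk₀, h1, h2⟩ := Classical.choose_spec hex
    set k₀ := Classical.choose hex with hk₀def
    -- the two scores agree (each is ≤ the other)
    have hle1 := (hcloud k hk k₀ hk₀ i).1
    have hle2 := (hcloud k₀ hk₀ k hk i).1
    rw [h1, h2] at hle2
    have heq : (sc k ((p k).1 i) i ((p k).2 i) : ℚ) = (sc k₀ ((p k).1 i) i ((p k).2 i) : ℚ) := by
      rw [hsc k hk, hsc k₀ hk₀]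
      exact congrArg _ (le_antisymm hle1 hle2)
    have heqz : sc k ((p k).1 i) i ((p k).2 i) = sc k₀ ((p k).1 i) i ((p k).2 i) := by exact_mod_cast heq
    rw [hv, ← heqz]
    simp only [sc]
    ring
  · -- strict slack at every other present incidence
    intro a b l hpres hne
    have hex : ∃ k', k' ≤ n ∧ (p k').1 b = a ∧ (p k').2 b = l := by
      by_contra hcon
      apply hpres
      rw [if_neg]
      rintro ⟨k', hk', h1, h2⟩
      exact hcon ⟨k', hk', h1, h2⟩
    have hv : v a b l = - sc (Classical.choose hex) a b l := by simp only [v, dif_pos hex]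
    obtain ⟨hk₀, h1, h2⟩ := Classical.choose_spec hex
    set k₀ := Classical.choose hex with hk₀def
    have hns : ¬ ((p k).1 b = (p k₀).1 b ∧ (p k).2 b = (p k₀).2 b) := by
      rw [h1, h2]
      rintro ⟨e1, e2⟩
      rcases hne with hne | hne
      · exact hne e1
      · exact hne e2
    have hlt := (hcloud k₀ hk₀ k hk b).2 hns
    rw [h1, h2] at hlt
    have hltq : (sc k₀ a b l : ℚ) < (sc k a b l : ℚ) := by
      rw [hsc k₀ hk₀, hsc k hk]
      exact mul_lt_mul_of_pos_left hlt hNq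
    have hltz : sc k₀ a b l < sc k a b l := by exact_mod_cast hltq
    rw [hv]
    simp only [sc] at hltz ⊢
    linarith

/-- **THE POTENTIAL-CLOUD NORMAL FORM (kernel iff).**  A term sequence `p 0, …, p n` is the dominant chain of SOME design with exponents `d`
(`∃ v ε θ`: presence entries in `{−1, 0, 1}`, strictly increasing integer slopes, every `p k` the unique optimum at `θ k`) iff there are
strictly increasing integer slopes and rational row / column potentials `u k, w k` (`k ≤ n`) such that, for every `k ≤ n` and every column
`b`, the gauged score of the incidence of `p k` in column `b` is `≤` its score at every step `k' ≤ n`, strictly unless `p k'` carries the same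
incidence there.  Same left-hand side as the realisability dual `MasterLaw.exists_design_iff_no_certificate`; here the design is eliminated
on the PRIMAL side. [folklore: LP duality step by step; packaging of the cell] -/
theorem exists_design_iff_potentialClouds (d : Fin K → ℕ) (n : ℕ) (p : ℕ → Equiv.Perm (Fin m) × (Fin m → Fin K)) :
    (∃ (v ε : Fin m → Fin m → Fin K → ℤ) (θ : ℕ → ℤ), (∀ i j l, (ε i j l).natAbs ≤ 1) ∧
      (∀ k < n, θ k < θ (k + 1)) ∧ ∀ k ≤ n, IsDominant d v ε (θ k) (p k)) ↔
    ∃ (θ : ℕ → ℤ) (u w : ℕ → Fin m → ℚ), (∀ k < n, θ k < θ (k + 1)) ∧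
      ∀ k ≤ n, ∀ k' ≤ n, ∀ b : Fin m,
        (u k ((p k).1 b) + w k b - (θ k : ℚ) * (d ((p k).2 b) : ℚ) ≤
            u k' ((p k).1 b) + w k' b - (θ k' : ℚ) * (d ((p k).2 b) : ℚ)) ∧
        (¬ ((p k').1 b = (p k).1 b ∧ (p k').2 b = (p k).2 b) →
          u k ((p k).1 b) + w k b - (θ k : ℚ) * (d ((p k).2 b) : ℚ) <
            u k' ((p k).1 b) + w k' b - (θ k' : ℚ) * (d ((p k).2 b) : ℚ)) := by
  constructor
  · rintro ⟨v, ε, θ, _, hθ, hdom⟩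
    obtain ⟨u, w, h⟩ := potentialClouds_of_design d n p v ε θ hdom
    exact ⟨θ, u, w, hθ, h⟩
  · rintro ⟨θ, u, w, hθ, hcloud⟩
    obtain ⟨v, θ', hθ', hdom⟩ := design_of_potentialClouds d n p θ hθ u w hcloud
    refine ⟨v, _, θ', ?_, hθ', hdom⟩
    intro i j l
    by_cases h : ∃ k' ≤ n, (p k').1 j = i ∧ (p k').2 j = l
    · rw [if_pos h]; simp
    · rw [if_neg h]; simp

/-- **The unsigned census row as a bound for sequences carrying a potential cloud.**  `TropRowD m K B` iff every term sequence of format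
`(m, K)` with consecutive terms distinct that carries a potential cloud (for some exponent vector, slopes and potentials) has `n ≤ B`. -/
theorem tropRowD_iff_potentialClouds (m K B : ℕ) :
    TropRowD m K B ↔ ∀ (d : Fin K → ℕ) (n : ℕ) (p : ℕ → Equiv.Perm (Fin m) × (Fin m → Fin K)),
      (∀ k < n, p k ≠ p (k + 1)) →
      (∃ (θ : ℕ → ℤ) (u w : ℕ → Fin m → ℚ), (∀ k < n, θ k < θ (k + 1)) ∧
        ∀ k ≤ n, ∀ k' ≤ n, ∀ b : Fin m,
          (u k ((p k).1 b) + w k b - (θ k : ℚ) * (d ((p k).2 b) : ℚ) ≤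
              u k' ((p k).1 b) + w k' b - (θ k' : ℚ) * (d ((p k).2 b) : ℚ)) ∧
          (¬ ((p k').1 b = (p k).1 b ∧ (p k').2 b = (p k).2 b) →
            u k ((p k).1 b) + w k b - (θ k : ℚ) * (d ((p k).2 b) : ℚ) <
              u k' ((p k).1 b) + w k' b - (θ k' : ℚ) * (d ((p k).2 b) : ℚ))) →
      n ≤ B := by
  constructor
  · intro hT d n p hdist hcloud
    obtain ⟨v, ε, θ, _, hθ, hdom⟩ := (exists_design_iff_potentialClouds d n p).mpr hcloud
    refine hT d v ε n (fun k => θ k) (fun k => p k) ?_ (fun k => hdom k (Nat.lt_succ_iff.mp k.isLt)) ?_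
    · rw [Fin.strictMono_iff_lt_succ]
      intro k
      simpa using hθ k k.isLt
    · intro k
      simpa using hdist k k.isLt
  · intro H d v ε n θ p hθ hdom hdist
    let pN : ℕ → Equiv.Perm (Fin m) × (Fin m → Fin K) := fun k => if h : k < n + 1 then p ⟨k, h⟩ else p 0
    let θN : ℕ → ℤ := fun k => if h : k < n + 1 then θ ⟨k, h⟩ else 0
    have hpN : ∀ k (hk : k < n + 1), pN k = p ⟨k, hk⟩ := fun k hk => by simp only [pN, dif_pos hk]
    have hθN : ∀ k (hk : k < n + 1), θN k = θ ⟨k, hk⟩ := fun k hk => by simp only [θN, dif_pos hk]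
    refine H d n pN ?_ ?_
    · intro k hk
      rw [hpN k (by omega), hpN (k + 1) (by omega)]
      exact hdist ⟨k, hk⟩
    · have hdomN : ∀ k ≤ n, IsDominant d v ε (θN k) (pN k) := by
        intro k hk
        rw [hpN k (by omega), hθN k (by omega)]
        exact hdom _
      obtain ⟨u, w, h⟩ := potentialClouds_of_design d n pN v ε θN hdomN
      refine ⟨θN, u, w, ?_, h⟩
      intro k hk
      rw [hθN k (by omega), hθN (k + 1) (by omega)]
      exact hθ (show (⟨k, by omega⟩ : Fin (n + 1)) < ⟨k + 1, by omega⟩ from Fin.mk_lt_mk.mpr (Nat.lt_succ_self k))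

end PotentialClouds

end Summit.ValiantsHypothesis.ValiantsHypothesis.Theorems.KPlusLogSqLaw
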